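import Summits.Ventures.CertifiedManyBodySolver.Rows.CorrWindowCertKernelChainQuotAdjFastNStages
import HarnessLib

/-!
# The chain step on LETTER CODES (part 4): `stepEQN r R vmax B C T H = stepEQA (boxQuot r R vmax) B C T H`, and the chain-file entry point

Parts 1–3 (`Rows/CorrWindowCertKernelChainQuotAdjFastN{,Key,Stages}.lean`) define the code step and transport the engine / `collect` through
`SOSDual.encL`. Here the (L7) box step `stepEQAFB` (`Rows/CorrWindowCertKernelChainQuotAdjFastBox.lean`) is mirrored stage by stage on keyed
code terms — `hintRowsN_eq`, `hintRowsB_inv` (every (L7) row is keyed by its target and signed `±1`), `annotateN_eq`, `zeroTestN_eq`,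
`quotOutNM_eq`, `termsToPolyKM_eq`, `adjOutNM_eq`, `toEnc_eq` — giving **`stepEQN_eq`** (unconditional: the guard's `else` branch falls back),
`stepEQN_eq'` (geometry by name) and THE CHAIN-FILE ENTRY POINT **`stepEQN_kernel`**:
`theorem step_s : C' = stepEQA D 2048 C T H := stepEQN_kernel 6 13 7 rfl (by decide +kernel)` — the SAME statement as with
`stepEQAFB_kernel`, a cheaper kernel evaluation (letters as ℕ codes, `Nat.blt`/`Nat.beq`/`Nat.ble`, one key per term carried through every
stage, monomials compared by key; measured on the tree's hub Gram steps ≈ ×1.5–1.7 vs (L7), HOME/hubbard-cov-la214-box-2/lean/g6/).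

HONEST FRAMING (xx1): Lean plumbing towards «tier P» — a PROOF-TERM-only speed-up of the kernel replay of chain steps; every
`step_s` STATEMENT, accumulator literal, census/EQUAL artefact, `ChainQAOK`/closer stays byte-identical. Nothing of record moves; no
certificate is evaluated here; no claim node is discharged; CONTROL/CALIBRATION context; silent on the presence of superconductivity;
not a `T_c` or phase sentence; nothing about any material; no summit statement is proved by this file. Cell `hubbard-obs` ×
`hubbard-downfold` (D-0154 (1)(C) La214), seat hubbard-cov-la214-box-2 g6 (`prover-hubbard-cov-la214-box-2-g6-0`), zero compute.

References: C. Jansson, D. Chaykin, C. Keil, SIAM J. Numer. Anal. 46 (2008) 180 [JanssonChaykinKeil2008]; X. Han, arXiv:2006.06002 §3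
[Han2020Bootstrap]; O. Bratteli, D. W. Robinson, *Operator Algebras and Quantum Statistical Mechanics 2* §5.2.2 [BratteliRobinsonII1997].
-/

namespace Summit.Ventures.CertifiedManyBodySolver

namespace CARPolyWindow

open Summit.Ventures.CertifiedQuantumChemistry Summit.Ventures.CertifiedQuantumChemistry.CARPoly
open Literature.MathematicalPhysics.QuantumLattice Literature.MathematicalPhysics.QuantumLattice.HubbardWave0

/-! ## §1 Stage-by-stage transport -/

section StageTransport

open BoxGeom

variable (r R vmax : ℕ)

/-- Encoding of a hint row. [folklore] -/
def encRow (ρ : HRow (boxN R) (boxN r)) : RowN := (ρ.1, (decide (ρ.2.2.1 = -1), encM SOSDual.encL ρ.2.2.2.μ))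

/-- Encoding of an accepted hint. [folklore] -/
def encE (e : ℚ × QHint (boxN r)) : Bool × MonoN := (decide (e.1 = -1), encM SOSDual.encL e.2.μ)

/-- Encoding of an annotated term. [folklore] -/
def encA (B : ℕ) (a : ATerm (boxN R) (boxN r)) : ATermN := (encKT SOSDual.encL B a.1, a.2.map (encE r))

/-- Encoding of a (monomial, coefficient) pair. [folklore] -/
def encMC (mc : CARPoly.Mono (Orb (Fin (boxN R))) × ℚ) : MonoN × ℚ := (encM SOSDual.encL mc.1, mc.2)

/-- One hint, both sides (the `filterMap` bodies). [cite: Han2020Bootstrap, §3] -/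
theorem hintRowN_eq (hR : r + vmax ≤ R) (B : ℕ) (h : QHint (boxN r)) :
    (bif boxOk vmax h.γ h.v then
      let w1 := (h.v.1 + (vmax : ℤ)).toNat
      let w2 := (h.v.2 + (vmax : ℤ)).toNat
      let g := gqK (side r) (side R) (w1 + (R - r) - vmax) (w2 + (R - r) - vmax) (R + r + w1 - vmax) (R + r + w2 - vmax) h.γ.val
      match monoNFN (((encM SOSDual.encL h.μ).1.map g), ((encM SOSDual.encL h.μ).2.map g)) with
      | some ns => some (keyN B ns.1, (ns.2, encM SOSDual.encL h.μ))
      | none => none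
    else none) =
    (if boxOk vmax h.γ h.v then
      match hintTgtB r R vmax B h with
      | [(m, ε)] => some (CARPoly.Mono.key SOSDual.encL B m, (m, (ε, h)))
      | _ => none
    else none).map (encRow r R) := by
  cases hb : boxOk vmax h.γ h.v with
  | false => simp
  | true =>
    simp only [cond_true, if_true]
    have eg : (((encM SOSDual.encL h.μ).1.map (gqK (side r) (side R) ((h.v.1 + (vmax : ℤ)).toNat + (R - r) - vmax)
        ((h.v.2 + (vmax : ℤ)).toNat + (R - r) - vmax) (R + r + (h.v.1 + (vmax : ℤ)).toNat - vmax) (R + r + (h.v.2 + (vmax : ℤ)).toNat - vmax)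
        h.γ.val)), ((encM SOSDual.encL h.μ).2.map (gqK (side r) (side R) ((h.v.1 + (vmax : ℤ)).toNat + (R - r) - vmax)
        ((h.v.2 + (vmax : ℤ)).toNat + (R - r) - vmax) (R + r + (h.v.1 + (vmax : ℤ)).toNat - vmax) (R + r + (h.v.2 + (vmax : ℤ)).toNat - vmax)
        h.γ.val))) = encM SOSDual.encL (mapMono (gqN r R vmax h.γ (h.v.1 + (vmax : ℤ)).toNat (h.v.2 + (vmax : ℤ)).toNat) h.μ) := by
      rw [encM_mapMono_gqN]
      simp only [encM, List.map_map, Function.comp_def, gqK_encL hR h.γ h.v hb]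
    rw [eg, hintTgtB]
    rcases h1 : sortS (mapMono (gqN r R vmax h.γ (h.v.1 + (vmax : ℤ)).toNat (h.v.2 + (vmax : ℤ)).toNat) h.μ).1 with _ | lc
    · rw [monoNFN_map_none1 SOSDual.encL encL_lt_iff h1, normalizeM_single_none1 SOSDual.encL B h1]; rfl
    · rcases h2 : sortS (mapMono (gqN r R vmax h.γ (h.v.1 + (vmax : ℤ)).toNat (h.v.2 + (vmax : ℤ)).toNat) h.μ).2 with _ | la
      · rw [monoNFN_map_none2 SOSDual.encL encL_lt_iff h2, normalizeM_single_none2 SOSDual.encL B h2]; rfl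
      · rw [monoNFN_map_some SOSDual.encL encL_lt_iff h1 h2, normalizeM_single_some SOSDual.encL B h1 h2]
        simp only [Option.map_some, encRow, decide_one_mul_sgnQ, keyN_encM]

/-- **Code hint rows ARE the (L7) box hint rows, encoded.** [cite: Han2020Bootstrap, §3] -/
theorem hintRowsN_eq (hR : r + vmax ≤ R) (B : ℕ) (H : List (QHint (boxN r))) :
    hintRowsN r R vmax B H = (hintRowsB r R vmax B H).map (encRow r R) := by
  rw [hintRowsN, hintRowsB, List.map_filterMap]
  congr 1
  funext h
  exact hintRowN_eq r R vmax hR B h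

/-- Invariant of ONE (L7) row: the key IS the key of the target, the sign is `±1`. [folklore] -/
theorem hintRowB_inv (B : ℕ) (h : QHint (boxN r)) (ρ : HRow (boxN R) (boxN r))
    (hρ : (if boxOk vmax h.γ h.v then
      match hintTgtB r R vmax B h with
      | [(m, ε)] => some (CARPoly.Mono.key SOSDual.encL B m, (m, (ε, h)))
      | _ => none
    else none) = some ρ) :
    ρ.1 = CARPoly.Mono.key SOSDual.encL B ρ.2.1 ∧ (ρ.2.2.1 = 1 ∨ ρ.2.2.1 = -1) := by
  split_ifs at hρ with hok
  rw [hintTgtB] at hρ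
  rcases h1 : sortS (mapMono (gqN r R vmax h.γ (h.v.1 + (vmax : ℤ)).toNat (h.v.2 + (vmax : ℤ)).toNat) h.μ).1 with _ | lc
  · rw [normalizeM_single_none1 SOSDual.encL B h1] at hρ; simp at hρ
  · rcases h2 : sortS (mapMono (gqN r R vmax h.γ (h.v.1 + (vmax : ℤ)).toNat (h.v.2 + (vmax : ℤ)).toNat) h.μ).2 with _ | la
    · rw [normalizeM_single_none2 SOSDual.encL B h2] at hρ; simp at hρ
    · rw [normalizeM_single_some SOSDual.encL B h1 h2] at hρ
      simp only [Option.some.injEq] at hρ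
      subst hρ
      exact ⟨rfl, one_mul_sgnQ_cases _⟩

/-- Invariant of the (L7) rows. [folklore] -/
theorem hintRowsB_inv (B : ℕ) (H : List (QHint (boxN r))) :
    ∀ ρ ∈ hintRowsB r R vmax B H, ρ.1 = CARPoly.Mono.key SOSDual.encL B ρ.2.1 ∧ (ρ.2.2.1 = 1 ∨ ρ.2.2.1 = -1) := by
  intro ρ hρ
  rw [hintRowsB, List.mem_filterMap] at hρ
  obtain ⟨h, _, hh⟩ := hρ
  exact hintRowB_inv r R vmax B h ρ hh

/-- `dropBehindN` on encoded rows. [folklore] -/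
theorem dropBehindN_map (k : ℕ) : ∀ ρs : List (HRow (boxN R) (boxN r)),
    dropBehindN k (ρs.map (encRow r R)) = (dropBehind k ρs).map (encRow r R)
  | [] => rfl
  | ρ :: ρs => by
    rw [List.map_cons, dropBehindN, dropBehind]
    have e : Nat.blt (encRow r R ρ).1 k = decide (ρ.1 < k) := by
      rw [Bool.eq_iff_iff, Nat.blt_eq, decide_eq_true_iff]; rfl
    rw [e]
    by_cases h : ρ.1 < k
    · rw [decide_eq_true h, cond_true, if_pos h, dropBehindN_map k ρs]
    · rw [decide_eq_false h, cond_false, if_neg h, List.map_cons]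

/-- **The keyed merge-walk IS `annotateG`, encoded** (rows whose key is the key of their target and whose sign is nonzero).
[folklore] -/
theorem annotateN_eq {B : ℕ} (hB : 2 * boxN R + 1 ≤ B) : ∀ (P : CARPoly.Poly (Orb (Fin (boxN R)))) (ρs : List (HRow (boxN R) (boxN r))),
    (∀ ρ ∈ ρs, ρ.1 = CARPoly.Mono.key SOSDual.encL B ρ.2.1 ∧ (ρ.2.2.1 = 1 ∨ ρ.2.2.1 = -1)) →
    annotateN (P.map (encKT SOSDual.encL B)) (ρs.map (encRow r R)) = (annotateG B P ρs).map (encA r R B)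
  | [], ρs, _ => by rw [List.map_nil, annotateN, annotateG, List.map_nil]
  | t :: P, ρs, hρs => by
    have hB1 : 1 < B := by have := boxN_pos R; omega
    rw [List.map_cons, annotateN, annotateG]
    have ek : (encKT SOSDual.encL B t).1 = CARPoly.Mono.key SOSDual.encL B t.1 := rfl
    rw [ek, dropBehindN_map]
    have hsub := dropBehind_sublist (CARPoly.Mono.key SOSDual.encL B t.1) ρs
    cases hd : dropBehind (CARPoly.Mono.key SOSDual.encL B t.1) ρs with
    | nil =>
      have ih0 := annotateN_eq hB P [] (fun _ h => by simp at h)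
      rw [List.map_nil] at ih0
      simp only [List.map_nil, List.map_cons, ih0]
      rfl
    | cons ρ ρs' =>
      rw [hd] at hsub
      have hρ := hρs ρ (hsub ρ List.mem_cons_self)
      have hρs' : ∀ x ∈ ρs', x.1 = CARPoly.Mono.key SOSDual.encL B x.2.1 ∧ (x.2.2.1 = 1 ∨ x.2.2.1 = -1) :=
        fun x hx => hρs x (hsub x (List.mem_cons_of_mem _ hx))
      have hρρs' : ∀ x ∈ ρ :: ρs', x.1 = CARPoly.Mono.key SOSDual.encL B x.2.1 ∧ (x.2.2.1 = 1 ∨ x.2.2.1 = -1) :=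
        fun x hx => hρs x (hsub x hx)
      simp only [List.map_cons]
      have etest : Nat.beq (encRow r R ρ).1 (CARPoly.Mono.key SOSDual.encL B t.1) = rowOKG t.1 ρ := by
        rw [rowOKG]
        have hne : (!decide (ρ.2.2.1 = 0)) = true := by rcases hρ.2 with h | h <;> rw [h] <;> norm_num
        rw [hne, Bool.and_true]
        show Nat.beq ρ.1 _ = _
        rw [hρ.1]
        exact beq_key SOSDual.encL encL_lt_iff (encL_bd hB) hB1 ρ.2.1 t.1
      rw [etest]
      cases rowOKG t.1 ρ
      · have ih1 := annotateN_eq hB P (ρ :: ρs') hρρs'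
        rw [List.map_cons] at ih1
        simp only [cond_false, Bool.false_eq_true, if_false, List.map_cons, ih1]
        rfl
      · simp only [cond_true, if_true, List.map_cons, annotateN_eq hB P ρs' hρs']
        rfl

/-- Accepted hints of `annotateG` come from the rows. [folklore] -/
theorem annotateG_some_mem (B : ℕ) : ∀ (P : CARPoly.Poly (Orb (Fin (boxN R)))) (ρs : List (HRow (boxN R) (boxN r))),
    ∀ a ∈ annotateG B P ρs, ∀ e, a.2 = some e → ∃ ρ ∈ ρs, e = ρ.2.2
  | [], ρs, a, ha, e, he => by simp [annotateG] at ha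
  | t :: P, ρs, a, ha, e, he => by
    rw [annotateG] at ha
    have hsub := dropBehind_sublist (CARPoly.Mono.key SOSDual.encL B t.1) ρs
    split at ha
    · rcases List.mem_cons.1 ha with rfl | ha
      · simp at he
      · obtain ⟨ρ, hρ, _⟩ := annotateG_some_mem B P [] a ha e he
        simp at hρ
    · rename_i ρ ρs' hd
      rw [hd] at hsub
      split_ifs at ha with hok
      · rcases List.mem_cons.1 ha with rfl | ha
        · simp only [Option.some.injEq] at he
          exact ⟨ρ, hsub ρ List.mem_cons_self, he.symm⟩
        · obtain ⟨ρ', hρ', h'⟩ := annotateG_some_mem B P ρs' a ha e he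
          exact ⟨ρ', hsub ρ' (List.mem_cons_of_mem _ hρ'), h'⟩
      · rcases List.mem_cons.1 ha with rfl | ha
        · simp at he
        · obtain ⟨ρ', hρ', h'⟩ := annotateG_some_mem B P (ρ :: ρs') a ha e he
          exact ⟨ρ', hsub ρ' hρ', h'⟩

/-- The zero-class test on codes IS the (L7) test. [cite: Han2020Bootstrap, §3] -/
theorem zeroTestN_eq {B : ℕ} (hB : 2 * boxN R + 1 ≤ B) (μ' m : CARPoly.Mono (Orb (Fin (boxN R)))) (c : ℚ) :
    zeroTestN B (encM SOSDual.encL μ') (encKT SOSDual.encL B (m, c)) = decide (normalizeM SOSDual.encL B [(μ', 1)] = [(m, 1)]) := by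
  have hB1 : 1 < B := by have := boxN_pos R; omega
  rw [zeroTestN]
  rcases h1 : sortS μ'.1 with _ | ⟨l1, s1⟩
  · rw [monoNFN_map_none1 SOSDual.encL encL_lt_iff h1, normalizeM_single_none1 SOSDual.encL B h1]; simp
  · rcases h2 : sortS μ'.2 with _ | ⟨l2, s2⟩
    · rw [monoNFN_map_none2 SOSDual.encL encL_lt_iff h2, normalizeM_single_none2 SOSDual.encL B h2]; simp
    · rw [monoNFN_map_some SOSDual.encL encL_lt_iff h1 h2, normalizeM_single_some SOSDual.encL B h1 h2]
      dsimp only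
      rw [keyN_encM, show (encKT SOSDual.encL B (m, c)).1 = CARPoly.Mono.key SOSDual.encL B m from rfl,
        beq_key SOSDual.encL encL_lt_iff (encL_bd hB) hB1 (l1, l2) m]
      cases s1 <;> cases s2 <;> by_cases hm : (l1, l2) = m <;> norm_num [hm, sgnQ]

/-- **Quotient-out on codes IS `quotOutZMB`, encoded** (accepted signs are `±1`). [cite: Han2020Bootstrap, §3] -/
theorem quotOutNM_eq {B : ℕ} (hB : 2 * boxN R + 1 ≤ B) (A : List (ATerm (boxN R) (boxN r)))
    (hA : ∀ a ∈ A, ∀ e, a.2 = some e → e.1 = 1 ∨ e.1 = -1) :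
    quotOutNM r R B (A.map (encA r R B)) = (quotOutZMB r R B A).map (encMC R) := by
  induction A with
  | nil => rfl
  | cons a A ih =>
    have hA' : ∀ x ∈ A, ∀ e, x.2 = some e → e.1 = 1 ∨ e.1 = -1 := fun x hx => hA x (List.mem_cons_of_mem _ hx)
    simp only [quotOutNM, quotOutZMB, List.map_cons, List.flatMap_cons, List.map_append] at ih ⊢
    rw [ih hA']
    congr 1
    rcases a with ⟨⟨m, c⟩, _ | ⟨ε, h⟩⟩
    · rfl
    · have hε := hA _ List.mem_cons_self (ε, h) rfl
      simp only [encA, Option.map_some, encE]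
      have eμ : (((encM SOSDual.encL h.μ).1.map (pushC r R), (encM SOSDual.encL h.μ).2.map (pushC r R)) : MonoN) =
          encM SOSDual.encL (mapMono (pushN r R) h.μ) := (encM_mapMono_pushN r R h.μ).symm
      rw [eμ, zeroTestN_eq R hB]
      have hdT : decide ((-1 : ℚ) = -1) = true := by decide
      have hdF : decide ((1 : ℚ) = -1) = false := by decide
      rcases hε with rfl | rfl
      · rw [hdF, Bool.false_and, cond_false, if_neg Bool.false_ne_true, if_neg Bool.false_ne_true, List.map_cons,
          List.map_nil, div_one]
        rfl
      · rw [hdT, Bool.true_and]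
        cases decide (normalizeM SOSDual.encL B [(mapMono (pushN r R) h.μ, 1)] = [(m, 1)])
        · rw [cond_false, if_pos rfl, if_neg Bool.false_ne_true, List.map_cons, List.map_nil, div_neg, div_one]
          rfl
        · rw [cond_true, if_pos rfl, List.map_nil]

/-- `termsToPolyKM` on encoded pairs IS `termsToPolyM`, encoded. [cite: BratteliRobinsonII1997, §5.2.2] -/
theorem termsToPolyKM_eq (B : ℕ) (Q : List (CARPoly.Mono (Orb (Fin (boxN R))) × ℚ)) :
    termsToPolyKM B (Q.map (encMC R)) = (termsToPolyM Q).map (encKT SOSDual.encL B) := by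
  induction Q with
  | nil => rfl
  | cons mc Q ih =>
    simp only [termsToPolyKM, termsToPolyM, List.map_cons, List.flatMap_cons, List.map_append] at ih ⊢
    rw [ih]
    congr 1
    rw [encMC]
    dsimp only
    rcases h1 : sortS mc.1.1 with _ | lc
    · rw [monoNFN_map_none1 SOSDual.encL encL_lt_iff h1, monoNF_none1 h1]; rfl
    · rcases h2 : sortS mc.1.2 with _ | la
      · rw [monoNFN_map_none2 SOSDual.encL encL_lt_iff h2, monoNF_none2 h2]; rfl
      · rw [monoNFN_map_some SOSDual.encL encL_lt_iff h1 h2, monoNF_some h1 h2]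
        simp only [List.map_cons, List.map_nil, encKT, keyN_encM]
        cases xor lc.2 la.2 <;> simp [sgnQ]

/-- One term of the adjoint pass, both sides. [cite: Han2020Bootstrap, §3] -/
theorem adjTermNM_eq (B : ℕ) (t : CARPoly.Mono (Orb (Fin (boxN R))) × ℚ) :
    (match monoNFN ((encKT SOSDual.encL B t).2.1.2.reverse, (encKT SOSDual.encL B t).2.1.1.reverse) with
      | none => ((encKT SOSDual.encL B t).2.1, (encKT SOSDual.encL B t).2.2)
      | some ns => bif Nat.blt (keyN B ns.1) (encKT SOSDual.encL B t).1 then (ns.1, if ns.2 then -(encKT SOSDual.encL B t).2.2 else (encKT SOSDual.encL B t).2.2)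
          else ((encKT SOSDual.encL B t).2.1, (encKT SOSDual.encL B t).2.2)) = encMC R (adjTermM B t).1 := by
  have erev : (((encKT SOSDual.encL B t).2.1.2.reverse, (encKT SOSDual.encL B t).2.1.1.reverse) : MonoN) =
      encM SOSDual.encL (t.1.2.reverse, t.1.1.reverse) := by simp [encKT, encM, List.map_reverse]
  rw [erev, adjTermM, adjTgtF]
  rcases h1 : sortS (t.1.2.reverse, t.1.1.reverse).1 with _ | lc
  · rw [monoNFN_map_none1 SOSDual.encL encL_lt_iff h1, normalizeM_single_none1 SOSDual.encL B h1]; rfl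
  · rcases h2 : sortS (t.1.2.reverse, t.1.1.reverse).2 with _ | la
    · rw [monoNFN_map_none2 SOSDual.encL encL_lt_iff h2, normalizeM_single_none2 SOSDual.encL B h2]; rfl
    · rw [monoNFN_map_some SOSDual.encL encL_lt_iff h1 h2, normalizeM_single_some SOSDual.encL B h1 h2]
      dsimp only
      have hblt : ∀ a b : ℕ, Nat.blt a b = decide (a < b) := fun a b => by rw [Bool.eq_iff_iff, Nat.blt_eq, decide_eq_true_iff]
      rw [keyN_encM, show (encKT SOSDual.encL B t).1 = CARPoly.Mono.key SOSDual.encL B t.1 from rfl, hblt]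
      by_cases hlt : CARPoly.Mono.key SOSDual.encL B (lc.1, la.1) < CARPoly.Mono.key SOSDual.encL B t.1
      · rw [decide_eq_true hlt, cond_true, if_pos hlt]
        cases xor lc.2 la.2 <;> simp [sgnQ, encMC, encKT]
      · rw [decide_eq_false hlt, cond_false, if_neg hlt]
        rfl

/-- **The adjoint pass on codes IS `adjOutM`, encoded.** [cite: Han2020Bootstrap, §3] -/
theorem adjOutNM_eq (B : ℕ) (P : CARPoly.Poly (Orb (Fin (boxN R)))) :
    adjOutNM B (P.map (encKT SOSDual.encL B)) = (adjOutM B P).map (encMC R) := by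
  simp only [adjOutNM, adjOutM, List.map_map]
  apply List.map_congr_left
  intro t _
  exact adjTermNM_eq R B t

/-- `toEnc` of encoded terms IS `encPoly`. [folklore] -/
theorem toEnc_eq (B : ℕ) (P : CARPoly.Poly (Orb (Fin (boxN R)))) : toEnc (P.map (encKT SOSDual.encL B)) = SOSDual.encPoly P := by
  simp only [toEnc, SOSDual.encPoly, List.map_map]
  rfl

/-- `collectK ∘ termsToPolyKM` on encoded pairs IS `normalizeM`, encoded. [folklore] -/
theorem collectK_termsToPolyKM {B : ℕ} (hB : 2 * boxN R + 1 ≤ B) (Q : List (CARPoly.Mono (Orb (Fin (boxN R))) × ℚ)) :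
    collectK (termsToPolyKM B (Q.map (encMC R))) = (normalizeM SOSDual.encL B Q).map (encKT SOSDual.encL B) := by
  have hB1 : 1 < B := by have := boxN_pos R; omega
  rw [termsToPolyKM_eq, collectK_map SOSDual.encL encL_lt_iff (encL_bd hB) hB1, normalizeM]

/-! ## §2 The equation and the chain-file entry point -/

/-- **THE CODE STEP IS THE STEP at `boxQuot r R vmax`** (unconditional: the `r + vmax > R` branch falls back). [folklore] -/
theorem stepEQN_eq (B : ℕ) (C : SOSDual.EncPoly) (T : Terms (Orb (Fin (boxN R)))) (H : List (QHint (boxN r))) :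
    stepEQN r R vmax B C T H = stepEQA (boxQuot r R vmax) B C T H := by
  unfold stepEQN
  split_ifs with hg
  · obtain ⟨hRv, hB⟩ := hg
    have hB1 : 1 < B := by have := boxN_pos R; omega
    rw [← stepEQAFB_eq, stepEQAFB, if_pos hRv]
    dsimp only
    -- stage 0: raw normal form
    rw [collectK_termsToPolyKN SOSDual.encL encL_lt_iff (encL_bd hB) hB1]
    -- rows
    have hrows : sortByKeyB (hintRowsN r R vmax B H) = (CARPoly.sortByKey (hintRowsB r R vmax B H)).map (encRow r R) := by
      rw [sortByKeyB_eq, hintRowsN_eq r R vmax hRv]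
      exact sortByKey_mapVal (fun p : CARPoly.Mono (Orb (Fin (boxN R))) × (ℚ × QHint (boxN r)) =>
        (decide (p.2.1 = -1), encM SOSDual.encL p.2.2.μ)) (hintRowsB r R vmax B H)
    have hinv : ∀ ρ ∈ CARPoly.sortByKey (hintRowsB r R vmax B H),
        ρ.1 = CARPoly.Mono.key SOSDual.encL B ρ.2.1 ∧ (ρ.2.2.1 = 1 ∨ ρ.2.2.1 = -1) :=
      fun ρ hρ => hintRowsB_inv r R vmax B H ρ ((CARPoly.sortByKey_perm _).subset hρ)
    rw [hrows, annotateN_eq r R hB _ _ hinv]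
    -- quotient
    have hA : ∀ a ∈ annotateG B (normalizeS SOSDual.encL B T) (CARPoly.sortByKey (hintRowsB r R vmax B H)),
        ∀ e, a.2 = some e → e.1 = 1 ∨ e.1 = -1 := fun a ha e he => by
      obtain ⟨ρ, hρ, rfl⟩ := annotateG_some_mem r R B (normalizeS SOSDual.encL B T) _ a ha e he
      exact (hinv ρ hρ).2
    rw [quotOutNM_eq r R hB _ hA, collectK_termsToPolyKM R hB, adjOutNM_eq, collectK_termsToPolyKM R hB, toEnc_eq]
  · rfl

/-- The same equation against a geometry given BY NAME (`hD : D = boxQuot r R vmax`, e.g. `rfl` for a chain file's `def D`). [folklore] -/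
theorem stepEQN_eq' {D : QuotData (boxN R) (boxN r)} (hD : D = boxQuot r R vmax) (B : ℕ) (C : SOSDual.EncPoly)
    (T : Terms (Orb (Fin (boxN R)))) (H : List (QHint (boxN r))) :
    stepEQN r R vmax B C T H = stepEQA D B C T H := by
  rw [hD]; exact stepEQN_eq r R vmax B C T H

/-- **THE CHAIN-FILE ENTRY POINT.** A kernel fact `C' = stepEQA D B C T H` of a chain file at geometry `D = boxQuot r R vmax`
(by name, `hD := rfl`) from the Boolean evaluation of the CODE step:
`theorem step_s : C' = stepEQA D 2048 C T H := stepEQN_kernel 6 13 7 rfl (by decide +kernel)`. [folklore] -/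
theorem stepEQN_kernel {D : QuotData (boxN R) (boxN r)} (hD : D = boxQuot r R vmax) {B : ℕ} {C C' : SOSDual.EncPoly}
    {T : Terms (Orb (Fin (boxN R)))} {H : List (QHint (boxN r))} (h : (C' == stepEQN r R vmax B C T H) = true) :
    C' = stepEQA D B C T H :=
  (eq_of_beq h).trans (stepEQN_eq' r R vmax hD B C T H)

end StageTransport

end CARPolyWindow

end Summit.Ventures.CertifiedManyBodySolver
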